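import Mathlib
import Literature.Analysis.FluidPDE.VectorCalculus
import Literature.Analysis.FluidPDE.RadialCalculus
import Summits.NavierStokesRegularity.NavierStokesRegularity.Theorems.ThreadingFluxHorizonTowerProfileFormulas
import HarnessLib

/-!
# Crux `PoloidalLiouville` (stmt-NavierStokesRegularity-1222, W1), crux idea «kinematic-shadow» (ns-idea-15 g6):
# calculus for the POINT-SOURCE DIPOLE — a negative-side witness in the kinematic shadow of the wall

Support file (`--supports stmt-NavierStokesRegularity-1222`, helper), first of two.  Experiment cell `ns-wall-extremal`,
width hand ns-wall-eng-5 g6.  0 kit.  Pure calculus on `ℝ³ ∖ {0}`; nothing here is specific to Navier–Stokes.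

The card `Cruxes/PoloidalLiouville/Ideas/kinematic-shadow.md` studies the wall's exact potential law with the Biot–Savart
coupling dropped: for a drift `u` and a toroidal potential `T` about the centre `0`, the STEADY KINEMATIC LAW
`∇(⟪u, ∇T⟫ − ΔT) × x = ∇⟪u, x⟫ × ∇T` (sketch `KinematicShadowSketch.lean`, `SteadyKinematicLawOn`), i.e. the steady
induction equation for the toroidal field `B = ∇T × x`.  Its REMARK (d) says the whole-space shadow «is decided at the
centre», and §B records the `l = 1` separable family driven by the point-source drift `u = c₀ x/‖x‖³`.  This file and its
sequel `UnthreadedDoorKinematicShadowPointSourceDipole` solve that family in closed form for `c₀ = 1` and land its BOUNDED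
member as a kernel theorem.  Here, for an abstract radial profile `P` (in the variable `σ = ‖x‖²`):

* `PointSource.divergence_drift`, `norm_drift`, `gradient_loopMomentum` — the unit point source `u(x) = x/‖x‖³` is
  divergence free off the origin, `‖u(x)‖ = ‖x‖⁻²`, and its loop momentum `m = ⟪u, x⟫ = ‖x‖⁻¹` has `∇m = −x/‖x‖³`;
* `PointSource.gradient_potential`, `laplacian_potential` — for `T(x) = ⟪e, x⟫ P(‖x‖²)`:
  `∇T = P e + 2⟪e,x⟫P′ x` and `ΔT = ⟪e,x⟫(4‖x‖² P″ + 10 P′)` off the origin (local hypotheses on `P` only);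
* `PointSource.steadyKinematicLaw_of_radialODE` — if `P` satisfies the radial ODE `4σP″ + 10P′ = 2σ^{−1/2}P′` on `σ > 0`
  (equivalently `h″ + (4/r − 1/r²)h′ = 0` for `h(r) = P(r²)`), then `⟪u,∇T⟫ − ΔT = ⟪e,x⟫ P(‖x‖²)/‖x‖³` and the steady
  kinematic law holds at every `x ≠ 0`, both sides being `(P(‖x‖²)/‖x‖³) · (e × x)`.

HONEST FRAME: vector calculus about an explicit linear (kinematic) system; nothing here bears on `PoloidalLiouville` (1222),
on the typed shadow `KinematicShadowSteady`, or on NS regularity — all OPEN.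

## References
* A. J. Majda, A. L. Bertozzi, *Vorticity and Incompressible Flow* (CUP 2002), §1.1 (vector identities). [MajdaBertozziCUP2002]
* H. K. Moffatt, *Magnetic Field Generation in Electrically Conducting Fluids* (CUP 1978), §2.1–2.3 (toroidal/poloidal
  fields, the induction equation). [Moffatt1978]
-/

-- the summit and its single problem share the name (D-0017 nested layout)
set_option linter.dupNamespace false

noncomputable section

namespace Summit.NavierStokesRegularity.NavierStokesRegularity.Theorems.PoloidalLiouville.KinematicShadow

open Set Function Filter Topology Metric
open scoped Topology RealInnerProductSpace Laplacian ContDiff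
open Literature.Analysis.FluidPDE
open Summit.NavierStokesRegularity.NavierStokesRegularity.Theorems.PoloidalLiouville.HorizonTower
  (E3 gradient_mul_apply gradient_comp_norm_sq divergence_gradient_eq_laplacian_of_contDiffAt)

namespace PointSource

/-! ### Cross-product and divergence bookkeeping in `ℝ³` -/

/-- `v × (a w) = a (v × w)`. -/
theorem cross_smul_right (a : ℝ) (v w : E3) : cross v (a • w) = a • cross v w := by
  rw [← crossCLM_apply, ← crossCLM_apply, map_smul]

/-- `v × (w + z) = v × w + v × z`. -/
theorem cross_add_right (v w z : E3) : cross v (w + z) = cross v w + cross v z := by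
  rw [← crossCLM_apply, ← crossCLM_apply, ← crossCLM_apply, map_add]

/-- `v × v = 0`. -/
theorem cross_self (v : E3) : cross v v = 0 := by
  unfold cross; simp

/-- `v × w = −(w × v)`. -/
theorem cross_anticomm (v w : E3) : cross v w = -cross w v := by
  unfold cross; rw [← _root_.cross_anticomm, WithLp.toLp_neg]

/-- `‖v × w‖ ≤ ‖v‖ ‖w‖`. -/
theorem norm_cross_le (v w : E3) : ‖cross v w‖ ≤ ‖v‖ * ‖w‖ := by
  rw [norm_cross]
  have h1 : Real.sin (InnerProductGeometry.angle v w) ≤ 1 := Real.sin_le_one _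
  have h0 : 0 ≤ ‖v‖ * ‖w‖ := by positivity
  nlinarith

/-- `div (x ↦ x) = 3` on `ℝ³`. -/
theorem divergence_id (x : E3) : VectorCalculus.divergence (fun y : E3 => y) x = 3 := by
  have h : (fderiv ℝ (fun y : E3 => y) x : E3 →ₗ[ℝ] E3) = LinearMap.id := by
    rw [show (fun y : E3 => y) = id from rfl, fderiv_id]; rfl
  rw [VectorCalculus.divergence, h, LinearMap.trace_id, finrank_euclideanSpace_fin]; norm_num

/-- `div (x ↦ c) = 0`. -/
theorem divergence_const (c x : E3) : VectorCalculus.divergence (fun _ : E3 => c) x = 0 := by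
  simp [VectorCalculus.divergence]

/-- `div (v + w) = div v + div w` at a point where both are differentiable. -/
theorem divergence_add {v w : E3 → E3} {x : E3} (hv : DifferentiableAt ℝ v x) (hw : DifferentiableAt ℝ w x) :
    VectorCalculus.divergence (fun y => v y + w y) x
      = VectorCalculus.divergence v x + VectorCalculus.divergence w x := by
  simp only [VectorCalculus.divergence, fderiv_fun_add hv hw, ContinuousLinearMap.toLinearMap_add, map_add]

/-! ### The unit point source `u(x) = x/‖x‖³` off the origin -/

/-- The radial factor `(‖x‖³)⁻¹` as a function of `σ = ‖x‖²`: `(σ√σ)⁻¹`. -/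
theorem norm_pow_three_inv_eq (x : E3) : (‖x‖ ^ 3)⁻¹ = (‖x‖ ^ 2 * Real.sqrt (‖x‖ ^ 2))⁻¹ := by
  rw [Real.sqrt_sq (norm_nonneg x)]; ring_nf

/-- Derivative of `σ ↦ (σ√σ)⁻¹` at `σ > 0`: `−3/(2σ²√σ)`. -/
theorem hasDerivAt_inv_mul_sqrt {σ : ℝ} (hσ : 0 < σ) :
    HasDerivAt (fun s : ℝ => (s * Real.sqrt s)⁻¹) (-(3 / (2 * σ ^ 2 * Real.sqrt σ))) σ := by
  have hs : 0 < Real.sqrt σ := Real.sqrt_pos.2 hσ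
  have h1 : HasDerivAt (fun s : ℝ => s * Real.sqrt s) (1 * Real.sqrt σ + σ * (1 / (2 * Real.sqrt σ))) σ :=
    (hasDerivAt_id σ).mul (Real.hasDerivAt_sqrt hσ.ne')
  have hne : σ * Real.sqrt σ ≠ 0 := by positivity
  have key : ∀ t : ℝ, 0 < t →
      -(3 / (2 * (t ^ 2) ^ 2 * t)) = -(1 * t + t ^ 2 * (1 / (2 * t))) / (t ^ 2 * t) ^ 2 := by
    intro t ht
    field_simp
    ring
  have hval := key (Real.sqrt σ) hs
  rw [Real.sq_sqrt hσ.le] at hval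
  rw [hval]
  exact h1.inv hne

/-- The point source is `C^n` off the origin, every `n`. -/
theorem contDiffAt_drift {x : E3} (hx : x ≠ 0) {n : WithTop ℕ∞} :
    ContDiffAt ℝ n (fun z : E3 => (‖z‖ ^ 3)⁻¹ • z) x := by
  have h1 : ContDiffAt ℝ n (fun z : E3 => ‖z‖) x := contDiffAt_norm ℝ hx
  have h2 : ContDiffAt ℝ n (fun z : E3 => (‖z‖ ^ 3)⁻¹) x :=
    (h1.pow 3).inv (by positivity)
  exact h2.smul contDiffAt_id

/-- The point source is `C^n` on the punctured space. -/
theorem contDiffOn_drift {n : WithTop ℕ∞} : ContDiffOn ℝ n (fun z : E3 => (‖z‖ ^ 3)⁻¹ • z) ({0}ᶜ : Set E3) :=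
  fun _ hx => (contDiffAt_drift hx).contDiffWithinAt

/-- `‖u(x)‖ = ‖x‖⁻²` off the origin. -/
theorem norm_drift {x : E3} (hx : x ≠ 0) : ‖(‖x‖ ^ 3)⁻¹ • x‖ = (‖x‖ ^ 2)⁻¹ := by
  have hr : 0 < ‖x‖ := norm_pos_iff.2 hx
  rw [norm_smul, norm_inv, norm_pow, norm_norm]
  field_simp

/-- **The point source is divergence free off the origin**: `div (x/‖x‖³) = 3/‖x‖³ − 3‖x‖²/‖x‖⁵ = 0`. -/
theorem divergence_drift {x : E3} (hx : x ≠ 0) :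
    VectorCalculus.divergence (fun z : E3 => (‖z‖ ^ 3)⁻¹ • z) x = 0 := by
  have hσ : 0 < ‖x‖ ^ 2 := by positivity
  have hr : 0 < ‖x‖ := norm_pos_iff.2 hx
  have hfun : (fun z : E3 => (‖z‖ ^ 3)⁻¹ • z) = fun z : E3 => (‖z‖ ^ 2 * Real.sqrt (‖z‖ ^ 2))⁻¹ • z := by
    funext z; rw [norm_pow_three_inv_eq]
  have hd := hasDerivAt_inv_mul_sqrt hσ
  have hθ : DifferentiableAt ℝ (fun z : E3 => (‖z‖ ^ 2 * Real.sqrt (‖z‖ ^ 2))⁻¹) x :=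
    (hasFDerivAt_comp_norm_sq (g := fun s : ℝ => (s * Real.sqrt s)⁻¹) hd).differentiableAt
  rw [hfun, HorizonTower.divergence_smul_apply (u := fun y => y) hθ differentiableAt_id, divergence_id,
    fderiv_comp_norm_sq_apply (g := fun s : ℝ => (s * Real.sqrt s)⁻¹) hd, real_inner_self_eq_norm_sq,
    Real.sqrt_sq hr.le]
  field_simp
  ring

/-- The loop momentum of the point source is `m(x) = ⟪u(x), x⟫ = ‖x‖⁻¹` off the origin. -/
theorem inner_drift_self {x : E3} (hx : x ≠ 0) : ⟪(‖x‖ ^ 3)⁻¹ • x, x⟫ = ‖x‖⁻¹ := by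
  have hr : 0 < ‖x‖ := norm_pos_iff.2 hx
  rw [real_inner_smul_left, real_inner_self_eq_norm_sq]
  field_simp

/-- `∇(‖·‖⁻¹)(x) = −x/‖x‖³` off the origin. -/
theorem gradient_norm_inv {x : E3} (hx : x ≠ 0) :
    gradient (fun w : E3 => ‖w‖⁻¹) x = (-(‖x‖ ^ 3)⁻¹) • x := by
  have hq : (‖x‖ ^ 2) ≠ 0 := by positivity
  have hr : 0 < ‖x‖ := norm_pos_iff.2 hx
  have hs : Real.sqrt (‖x‖ ^ 2) ≠ 0 := by rw [Real.sqrt_sq (norm_nonneg x)]; exact hr.ne'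
  have hd : HasDerivAt (fun s : ℝ => (Real.sqrt s)⁻¹) (-(1 / (2 * Real.sqrt (‖x‖ ^ 2))) / Real.sqrt (‖x‖ ^ 2) ^ 2)
      (‖x‖ ^ 2) := (Real.hasDerivAt_sqrt hq).inv hs
  have h := gradient_comp_norm_sq (g := fun s : ℝ => (Real.sqrt s)⁻¹) (z := x) hd
  have e : (fun w : E3 => (fun s : ℝ => (Real.sqrt s)⁻¹) (‖w‖ ^ 2)) = fun w => ‖w‖⁻¹ :=
    funext fun w => by simp only [Real.sqrt_sq (norm_nonneg w)]
  rw [e, Real.sqrt_sq (norm_nonneg x)] at h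
  rw [h]
  congr 1
  field_simp

/-- **Loop momentum gradient**: `∇⟪u, x⟫ = ∇(‖x‖⁻¹) = −x/‖x‖³` off the origin. -/
theorem gradient_loopMomentum {x : E3} (hx : x ≠ 0) :
    gradient (fun z : E3 => ⟪(‖z‖ ^ 3)⁻¹ • z, z⟫) x = (-(‖x‖ ^ 3)⁻¹) • x := by
  have hev : (fun z : E3 => ⟪(‖z‖ ^ 3)⁻¹ • z, z⟫) =ᶠ[𝓝 x] fun z : E3 => ‖z‖⁻¹ := by
    filter_upwards [isOpen_compl_singleton.mem_nhds hx] with z hz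
    exact inner_drift_self hz
  rw [hev.gradient_eq, gradient_norm_inv hx]

/-! ### The potential `T(x) = ⟪e, x⟫ P(‖x‖²)` off the origin -/

section Potential

variable {e x : E3} {P P₁ : ℝ → ℝ}

/-- **`∇(⟪e,·⟫ P(‖·‖²))(x) = P(‖x‖²) e + 2⟪e,x⟫P′(‖x‖²) x`** at a point where `P` is differentiable at `‖x‖²`. -/
theorem gradient_potential {p₁ : ℝ} (hP : HasDerivAt P p₁ (‖x‖ ^ 2)) :
    gradient (fun z : E3 => ⟪e, z⟫ * P (‖z‖ ^ 2)) x = P (‖x‖ ^ 2) • e + (2 * ⟪e, x⟫ * p₁) • x := by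
  have hf : DifferentiableAt ℝ (fun z : E3 => ⟪e, z⟫) x := (innerSL ℝ e : E3 →L[ℝ] ℝ).differentiableAt
  have hg : DifferentiableAt ℝ (fun z : E3 => P (‖z‖ ^ 2)) x := (hasFDerivAt_comp_norm_sq hP).differentiableAt
  -- `∇⟪e, ·⟫ = e` (as in `LinearLiouvilleSeven.Negative.gradient_inner_const_left`)
  have hge : gradient (fun z : E3 => ⟪e, z⟫) x = e := by
    refine HasGradientAt.gradient ?_
    rw [hasGradientAt_iff_hasFDerivAt]
    exact (InnerProductSpace.toDual ℝ E3 e).hasFDerivAt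
  rw [gradient_mul_apply hf hg, gradient_comp_norm_sq hP, hge, smul_smul, add_comm]
  congr 1; ring

/-- **`Δ(⟪e,·⟫ P(‖·‖²))(x) = ⟪e,x⟫ (4‖x‖² P″(‖x‖²) + 10 P′(‖x‖²))`** off the origin, for `P` differentiable with
derivative `P₁` on an open set `U ∋ ‖x‖²` of radii, `P₁` differentiable at `‖x‖²` and `P` of class `C²` at `‖x‖²`
(computed as `div ∇T` with the local Leibniz rules of `ThreadingFluxHorizonTowerProfileFormulas`). -/
theorem laplacian_potential {p₂ : ℝ} {U : Set ℝ} (hU : IsOpen U) (hxU : ‖x‖ ^ 2 ∈ U)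
    (hP : ∀ σ ∈ U, HasDerivAt P (P₁ σ) σ) (hP₁ : HasDerivAt P₁ p₂ (‖x‖ ^ 2)) (hP2 : ContDiffAt ℝ 2 P (‖x‖ ^ 2)) :
    (Δ fun z : E3 => ⟪e, z⟫ * P (‖z‖ ^ 2)) x = ⟪e, x⟫ * (4 * ‖x‖ ^ 2 * p₂ + 10 * P₁ (‖x‖ ^ 2)) := by
  -- `T` is `C²` at `x`
  have hT2 : ContDiffAt ℝ 2 (fun z : E3 => ⟪e, z⟫ * P (‖z‖ ^ 2)) x :=
    (innerSL ℝ e : E3 →L[ℝ] ℝ).contDiff.contDiffAt.mul (hP2.comp x (contDiff_norm_sq ℝ).contDiffAt)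
  rw [← divergence_gradient_eq_laplacian_of_contDiffAt hT2]
  -- `∇T` near `x`
  have hev : gradient (fun z : E3 => ⟪e, z⟫ * P (‖z‖ ^ 2)) =ᶠ[𝓝 x]
      fun z : E3 => P (‖z‖ ^ 2) • e + (2 * ⟪e, z⟫ * P₁ (‖z‖ ^ 2)) • z := by
    have hpre : (fun z : E3 => ‖z‖ ^ 2) ⁻¹' U ∈ 𝓝 x :=
      (contDiff_norm_sq ℝ (n := 0)).continuous.continuousAt.preimage_mem_nhds (hU.mem_nhds hxU)
    filter_upwards [hpre] with z hz
    exact gradient_potential (hP _ hz)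
  rw [show VectorCalculus.divergence (gradient fun z : E3 => ⟪e, z⟫ * P (‖z‖ ^ 2)) x
      = VectorCalculus.divergence (fun z : E3 => P (‖z‖ ^ 2) • e + (2 * ⟪e, z⟫ * P₁ (‖z‖ ^ 2)) • z) x by
    simp only [VectorCalculus.divergence, hev.fderiv_eq]]
  -- differentiability of the pieces at `x`
  have hPx : HasDerivAt P (P₁ (‖x‖ ^ 2)) (‖x‖ ^ 2) := hP _ hxU
  have hρ : DifferentiableAt ℝ (fun z : E3 => P (‖z‖ ^ 2)) x := (hasFDerivAt_comp_norm_sq hPx).differentiableAt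
  have hρ₁ : DifferentiableAt ℝ (fun z : E3 => P₁ (‖z‖ ^ 2)) x := (hasFDerivAt_comp_norm_sq hP₁).differentiableAt
  have hi : DifferentiableAt ℝ (fun z : E3 => ⟪e, z⟫) x := (innerSL ℝ e : E3 →L[ℝ] ℝ).differentiableAt
  have hc : DifferentiableAt ℝ (fun z : E3 => 2 * ⟪e, z⟫ * P₁ (‖z‖ ^ 2)) x := (hi.const_mul 2).mul hρ₁
  have h1 : DifferentiableAt ℝ (fun z : E3 => P (‖z‖ ^ 2) • e) x := hρ.smul (differentiableAt_const e)
  have h2 : DifferentiableAt ℝ (fun z : E3 => (2 * ⟪e, z⟫ * P₁ (‖z‖ ^ 2)) • z) x := hc.smul differentiableAt_id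
  rw [divergence_add h1 h2, HorizonTower.divergence_smul_apply (u := fun _ => e) hρ (differentiableAt_const e),
    HorizonTower.divergence_smul_apply (u := fun y => y) hc differentiableAt_id, divergence_const, divergence_id,
    fderiv_comp_norm_sq_apply hPx]
  -- the product derivative `D(2⟪e,·⟫P₁(‖·‖²))(x)[x]`
  have hinner : fderiv ℝ (fun z : E3 => ⟪e, z⟫) x x = ⟪e, x⟫ := by
    have hfun : (fun z : E3 => ⟪e, z⟫) = InnerProductSpace.toDual ℝ E3 e := by funext z; rfl
    rw [hfun, (InnerProductSpace.toDual ℝ E3 e).hasFDerivAt.fderiv]; rfl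
  have hprod : fderiv ℝ (fun z : E3 => 2 * ⟪e, z⟫ * P₁ (‖z‖ ^ 2)) x x
      = 2 * ⟪e, x⟫ * P₁ (‖x‖ ^ 2) + 2 * ⟪e, x⟫ * (2 * p₂ * ‖x‖ ^ 2) := by
    rw [fderiv_fun_mul (hi.const_mul 2) hρ₁]
    simp only [_root_.add_apply, _root_.FunLike.coe_smul, Pi.smul_apply, smul_eq_mul]
    rw [fderiv_const_mul hi]
    simp only [_root_.FunLike.coe_smul, Pi.smul_apply, smul_eq_mul]
    rw [hinner, fderiv_comp_norm_sq_apply hP₁, real_inner_self_eq_norm_sq]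
    ring
  rw [hprod, real_inner_comm]
  ring

end Potential

/-! ### The steady kinematic law for the pair (point source, separable dipole potential) -/

section Law

variable {e : E3} {P P₁ P₂ : ℝ → ℝ}

/-- **The scalar of the law.**  If `P` solves the radial ODE `4σP″(σ) + 10P′(σ) = 2σ^{−1/2}P′(σ)` on `σ > 0`, then for
the point source `u = x/‖x‖³` and `T = ⟪e,·⟫P(‖·‖²)`:  `⟪u, ∇T⟫ − ΔT = ⟪e, x⟫ · P(‖x‖²)/‖x‖³` off the origin
(the diffusion `ΔT = ⟪e,x⟫·2P′/‖x‖` is exactly balanced by the stretching part `2⟪e,x⟫P′/‖x‖` of the advection). -/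
theorem advection_sub_laplacian (hP : ∀ σ : ℝ, 0 < σ → HasDerivAt P (P₁ σ) σ)
    (hP₁ : ∀ σ : ℝ, 0 < σ → HasDerivAt P₁ (P₂ σ) σ) (hP2 : ∀ σ : ℝ, 0 < σ → ContDiffAt ℝ 2 P σ)
    (hODE : ∀ σ : ℝ, 0 < σ → 4 * σ * P₂ σ + 10 * P₁ σ = 2 * (Real.sqrt σ)⁻¹ * P₁ σ) {x : E3} (hx : x ≠ 0) :
    ⟪(‖x‖ ^ 3)⁻¹ • x, gradient (fun z : E3 => ⟪e, z⟫ * P (‖z‖ ^ 2)) x⟫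
        - (Δ fun z : E3 => ⟪e, z⟫ * P (‖z‖ ^ 2)) x
      = ⟪e, x⟫ * ((‖x‖ ^ 3)⁻¹ * P (‖x‖ ^ 2)) := by
  have hσ : 0 < ‖x‖ ^ 2 := by positivity
  have hr : 0 < ‖x‖ := norm_pos_iff.2 hx
  rw [gradient_potential (hP _ hσ),
    laplacian_potential isOpen_Ioi hσ (fun σ hσ' => hP σ hσ') (hP₁ _ hσ) (hP2 _ hσ),
    inner_add_right, real_inner_smul_right, real_inner_smul_right, real_inner_smul_left, real_inner_smul_left,
    real_inner_self_eq_norm_sq]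
  -- `4σP₂ + 10P₁ = 2P₁/‖x‖`
  have hode := hODE _ hσ
  rw [Real.sqrt_sq hr.le] at hode
  rw [hode, real_inner_comm x e]
  field_simp
  ring

/-- **The steady kinematic law for the point-source dipole.**  Under the radial ODE of `advection_sub_laplacian`, at every
`x ≠ 0`:  `∇(⟪u,∇T⟫ − ΔT)(x) × x = ∇⟪u, ·⟫(x) × ∇T(x)` — both sides equal `(P(‖x‖²)/‖x‖³) · (e × x)`. -/
theorem steadyKinematicLaw_of_radialODE (hP : ∀ σ : ℝ, 0 < σ → HasDerivAt P (P₁ σ) σ)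
    (hP₁ : ∀ σ : ℝ, 0 < σ → HasDerivAt P₁ (P₂ σ) σ) (hP2 : ∀ σ : ℝ, 0 < σ → ContDiffAt ℝ 2 P σ)
    (hODE : ∀ σ : ℝ, 0 < σ → 4 * σ * P₂ σ + 10 * P₁ σ = 2 * (Real.sqrt σ)⁻¹ * P₁ σ) {x : E3} (hx : x ≠ 0) :
    cross (gradient (fun z : E3 =>
        ⟪(‖z‖ ^ 3)⁻¹ • z, gradient (fun w : E3 => ⟪e, w⟫ * P (‖w‖ ^ 2)) z⟫
          - (Δ fun w : E3 => ⟪e, w⟫ * P (‖w‖ ^ 2)) z) x) x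
      = cross (gradient (fun z : E3 => ⟪(‖z‖ ^ 3)⁻¹ • z, z⟫) x)
          (gradient (fun w : E3 => ⟪e, w⟫ * P (‖w‖ ^ 2)) x) := by
  have hσ : 0 < ‖x‖ ^ 2 := by positivity
  have hr : 0 < ‖x‖ := norm_pos_iff.2 hx
  -- the scalar `f = ⟪u,∇T⟫ − ΔT` agrees near `x` with `⟪e,·⟫ Q(‖·‖²)`, `Q(σ) = (σ√σ)⁻¹ P(σ)`
  have hev : (fun z : E3 => ⟪(‖z‖ ^ 3)⁻¹ • z, gradient (fun w : E3 => ⟪e, w⟫ * P (‖w‖ ^ 2)) z⟫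
        - (Δ fun w : E3 => ⟪e, w⟫ * P (‖w‖ ^ 2)) z) =ᶠ[𝓝 x]
      fun z : E3 => ⟪e, z⟫ * ((‖z‖ ^ 2 * Real.sqrt (‖z‖ ^ 2))⁻¹ * P (‖z‖ ^ 2)) := by
    filter_upwards [isOpen_compl_singleton.mem_nhds hx] with z hz
    rw [advection_sub_laplacian hP hP₁ hP2 hODE hz, norm_pow_three_inv_eq]
  -- `Q` is differentiable at `‖x‖²`
  have hQ : HasDerivAt (fun s : ℝ => (s * Real.sqrt s)⁻¹ * P s)
      (-(3 / (2 * (‖x‖ ^ 2) ^ 2 * Real.sqrt (‖x‖ ^ 2))) * P (‖x‖ ^ 2)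
        + (‖x‖ ^ 2 * Real.sqrt (‖x‖ ^ 2))⁻¹ * P₁ (‖x‖ ^ 2)) (‖x‖ ^ 2) :=
    (hasDerivAt_inv_mul_sqrt hσ).mul (hP _ hσ)
  -- linearity of `cross` in the first slot (as in `Aksman2026.cross_add_left`, `HorizonTower.cross_smul_left`)
  have cross_add_left : ∀ v w z : E3, cross (v + w) z = cross v z + cross w z := fun v w z => by
    rw [← crossCLM_apply, ← crossCLM_apply, ← crossCLM_apply, map_add]; rfl
  have cross_smul_left : ∀ (a : ℝ) (v w : E3), cross (a • v) w = a • cross v w := fun a v w => by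
    rw [← crossCLM_apply, ← crossCLM_apply, map_smul]; rfl
  rw [hev.gradient_eq, gradient_potential hQ, gradient_loopMomentum hx, gradient_potential (hP _ hσ),
    cross_add_left, cross_smul_left, cross_smul_left, cross_self, smul_zero, add_zero,
    cross_smul_left, cross_add_right, cross_smul_right, cross_smul_right, cross_self, smul_zero, add_zero,
    cross_anticomm x e, smul_neg, neg_smul_neg, smul_smul, Real.sqrt_sq hr.le]
  ring_nf

end Law

end PointSource

end Summit.NavierStokesRegularity.NavierStokesRegularity.Theorems.PoloidalLiouville.KinematicShadow
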